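/-
Copyright (c) 2026. All rights reserved.
Released under Apache 2.0 license as described in the file LICENSE.
-/
import Literature.NumberTheory.ComplexMultiplication.DegenerateCMTypesAbelianStabilizerCharacters
import HarnessLib

/-!
# The stabiliser of a CM type on a finite abelian group bounds its Kubota rank: `2·|Stab(T)|·(rank(T) − 1) ≤ |G|`

SETTING (tree `CMTypeRankCharacters`, `DegenerateCMTypesAbelianStabilizerCharacters`; T. Kubota [Kubota1965] §4
Lemma 2 = B. B. Gordon [Gordon1999HodgeAVSurvey] Prop. 9.4.1).  `G` a finite commutative group — the Galois group of
an ABELIAN CM field `K` — `ρ ∈ G` (complex conjugation), `T ⊆ G` a CM type (`IsCMTypeWith ρ T`), `Ŝ(χ) = Σ_{t∈T} χ(t)`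
for `χ : AddChar (Additive G) ℂ`, `rank(T) = 1 + #{χ odd : Ŝ(χ) ≠ 0}` (Kubota; the odd `χ` with `Ŝ(χ) ≠ 0` are the
SURVIVORS), and `Stab(T) = {g : Tg = T}` the stabiliser — the joint kernel of the survivors (tree
`AbelianStabilizer.forall_mul_mem_iff_iff_forall_survivor`); on the field side `Stab(T) = Gal(K/K*)`, `K*` the reflex
field (G. Shimura [Shimura1998] §8.4 Example (1)).  THIS FILE counts the characters of `G/Stab(T)` inside `Ĝ`:

> **Theorem** (`two_mul_card_stabilizer_mul_typeRank_sub_one_le`).  For every CM type `T` on a finite commutative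
> group, `2·|Stab(T)|·(rank(T) − 1) ≤ |G|`, i.e. `rank(T) ≤ [G : Stab(T)]/2 + 1`
> (`typeRank_le_card_div_add_one`); **equality holds iff every odd character trivial on `Stab(T)` survives**
> (`two_mul_card_stabilizer_mul_eq_iff`) — `T` is induced from a NONDEGENERATE type of `G/Stab(T)`.

This is Shimura's `rank(Φ) ≤ [K* : ℚ]/2 + 1` ([Shimura1998] §32.10; tree `IsCMTypeWith.typeRank_le_card_orbit`, proved
there through the reflex type for a general `G`-set) in the case of `G` acting on itself, re-proved by character
counting and stated with the stabiliser: the survivors are odd characters trivial on `Stab(T)` (tree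
`survivor_apply_eq_one_of_forall_mul_mem_iff`), there are `|G|/|Stab(T)|` characters trivial on `Stab(T)`
(`card_stabilizer_mul_card_filter_eq`: `|S|·#{χ : χ|_S = 1} = |G|`, by summing `Σ_χ Σ_{s∈S} χ(s)` in both orders),
and exactly half of them are odd (`two_mul_card_filter_odd_eq`: `ρ ∉ Stab(T)`, so `Σ_{χ|_S = 1} χ(ρ) = 0`).  The
exponent-`2` predecessor is the tree's `ExponentTwo.typeRank_le_of_forall_mul_mem_iff` (`|Stab| ≥ 2 ⟹ rank ≤ |G|/4 + 1`),
here for every finite commutative `G` (`typeRank_le_card_div_four_of_forall_mul_mem_iff`); the equality case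
contains the nondegenerate types (`Stab = 1`), the kernel types `{χ₁ = 1}` (rank `2`, `|Stab| = |G|/2`) and the
majority types of the tree's `DegenerateCMTypesElementaryAbelianMajorityType` (rank `5`, `|Stab| = |G|/8`).

* §1 the stabiliser is a subgroup not containing `ρ`: `forall_mul_one_mem_iff`, `forall_mul_mul_mem_iff`,
  `forall_mul_inv_mem_iff`, `rho_not_forall_mul_mem_iff`, `mul_rho_ne_one_of_forall_mul_mem_iff`,
  `image_stabilizer_mul_eq`, `one_mem_stabilizer`, `card_stabilizer_pos`.
* §2 characters trivial on the stabiliser: `sum_char_stabilizer_eq` (`Σ_{s∈S} χ(s) = |S|·[χ|_S = 1]`),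
  **`card_stabilizer_mul_card_filter_eq`** (`|S|·#{χ|_S = 1} = |G|`), `card_stabilizer_dvd`,
  `sum_filter_apply_rho_eq_zero`, **`two_mul_card_filter_odd_eq`** (half of them are odd),
  `two_mul_card_stabilizer_mul_card_filter_odd_eq` (`2|S|·#{χ odd, χ|_S = 1} = |G|`).
* §3 the bound: `two_mul_card_stabilizer_mul_card_survivors_le`, **`two_mul_card_stabilizer_mul_typeRank_sub_one_le`**,
  `typeRank_le_card_div_add_one`, `typeRank_le_card_div_four_of_forall_mul_mem_iff`,
  **`two_mul_card_stabilizer_mul_eq_iff`** (the equality case).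

HONEST SCOPE.  Finite Fourier analysis (orthogonality `AddChar.sum_apply_eq_ite`) on Kubota's formula; the sources
print the formula (Kubota, Gordon), the reflex bound (Shimura §32.10) and the stabiliser–reflex dictionary (Shimura
§8.4); the stabiliser form, the counts and the equality criterion are this file's packaging, not numbered statements
of the sources.  THEOREMS ONLY: no definition, no named fact, no instance, no `sorry`.

## References

* [Kubota1965] T. Kubota, *On the field extension by complex multiplication*, Trans. AMS 118 (1965), §2 (p. 115),
  §4 Lemma 2 (p. 119).
* [Gordon1999HodgeAVSurvey] B. B. Gordon, *A survey of the Hodge conjecture for abelian varieties*, Prop. 9.4.1.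
* [Shimura1998] G. Shimura, *Abelian Varieties with Complex Multiplication and Modular Functions*, §8.4 Example (1),
  §32.10.
* [Dodson1984] B. Dodson, *The structure of Galois groups of CM-fields*, Trans. AMS 283 (1984), §3.1.0–§3.1.1.

## Provenance

Lane `lit-hodgefound` (Track 2, Layer A3), seat `lit-hodgefound-p10` generation 39, row g39-#6; neighbours cited by
name, nothing restated: `DegenerateCMTypesAbelianStabilizerCharacters` (`sum_char_image_mul_eq`,
`survivor_apply_eq_one_of_forall_mul_mem_iff`, `not_forall_mul_rho_mem_iff`), `CMTypeRankCharacters`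
(`IsCMTypeWith.typeRank_eq_one_add_ncard_oddCharacters`), `CMTori` (`IsCMTypeWith.typeRank_le_card_orbit`, the
`G`-set form), `CMTypeElementaryTwoGroupOddWeights` (`character_apply_eq_one_or_of_mul_self`), Mathlib
`AddChar.sum_apply_eq_ite`.
-/

open scoped BigOperators Classical

namespace Literature.NumberTheory.ComplexMultiplication

namespace CyclicCMType

namespace AbelianStabilizer

variable {G : Type*} [CommGroup G] [Fintype G] [DecidableEq G] {ρ : G} {T : Finset G}

/-! ## §0 Helpers -/

section Helpers

omit [Fintype G] [DecidableEq G] in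
/-- `χ(gh) = χ(g)χ(h)`. [folklore] -/
private theorem char_mul_ib (χ : AddChar (Additive G) ℂ) (g h : G) :
    χ (Additive.ofMul (g * h)) = χ (Additive.ofMul g) * χ (Additive.ofMul h) := by
  rw [ofMul_mul, AddChar.map_add_eq_mul]

/-- Dual orthogonality: `Σ_χ χ(x) = |G|·[x = 1]` (Mathlib `AddChar.sum_apply_eq_ite`). [folklore] -/
private theorem sum_char_apply_eq_ite_ib (x : G) :
    ∑ χ : AddChar (Additive G) ℂ, χ (Additive.ofMul x) = if x = 1 then (Fintype.card G : ℂ) else 0 := by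
  have h := AddChar.sum_apply_eq_ite (α := Additive G) (Additive.ofMul x)
  have hc : Fintype.card (Additive G) = Fintype.card G := Fintype.card_congr Additive.toMul
  rw [h, hc]
  rfl

omit [Fintype G] [DecidableEq G] in
/-- `ρ² = 1`. [folklore] -/
private theorem rho_mul_rho_ib (h : IsCMTypeWith ρ (T : Set G)) : ρ * ρ = 1 := by
  have := h.invol (1 : G)
  simpa [smul_eq_mul] using this

omit [Fintype G] [DecidableEq G] in
/-- `χ(ρ) = ±1`. [folklore] -/
private theorem char_rho_ib (h : IsCMTypeWith ρ (T : Set G)) (χ : AddChar (Additive G) ℂ) :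
    χ (Additive.ofMul ρ) = 1 ∨ χ (Additive.ofMul ρ) = -1 :=
  character_apply_eq_one_or_of_mul_self χ (rho_mul_rho_ib h)

omit [Fintype G] [DecidableEq G] in
/-- `ρx ∈ T ⟺ x ∉ T`. [folklore] -/
private theorem rho_mul_mem_iff_ib (h : IsCMTypeWith ρ (T : Set G)) (x : G) : ρ * x ∈ T ↔ x ∉ T := by
  have := h.rho_smul_mem_iff x
  simpa only [smul_eq_mul, Finset.mem_coe] using this

omit [Fintype G] [DecidableEq G] in
/-- A CM type is non-empty (it contains `1` or `ρ`). [folklore] -/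
private theorem nonempty_ib (h : IsCMTypeWith ρ (T : Set G)) : T.Nonempty := by
  by_cases h1 : (1 : G) ∈ T
  · exact ⟨1, h1⟩
  · exact ⟨ρ * 1, (rho_mul_mem_iff_ib h 1).2 h1⟩

omit [DecidableEq G] in
/-- Kubota's count with the survivors as a finset: `rank = 1 + #surv`. [cite: Kubota1965, §4 Lemma 2] -/
private theorem typeRank_eq_one_add_card_ib (h : IsCMTypeWith ρ (T : Set G)) :
    typeRank G (T : Set G) = 1 + ((Finset.univ.filter fun χ : AddChar (Additive G) ℂ =>
      χ (Additive.ofMul ρ) = -1).filter fun χ => ∑ s ∈ T, χ (Additive.ofMul s) ≠ 0).card := by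
  rw [h.typeRank_eq_one_add_ncard_oddCharacters, ← Set.ncard_coe_finset]
  congr 2
  ext χ
  simp only [Set.mem_setOf_eq, Finset.coe_filter, Finset.mem_filter, Finset.mem_univ, true_and]

/-- `|S|·#{χ : χ|_S = 1} = |G|` for a finset `S ∋ 1` on which every character sums to `|S|·[χ|_S = 1]` (sum
`Σ_χ Σ_{s∈S} χ(s)` in both orders). [folklore] -/
private theorem card_mul_card_filter_eq_ib {S : Finset G} (h1 : (1 : G) ∈ S)
    (hsum : ∀ χ : AddChar (Additive G) ℂ, ∑ s ∈ S, χ (Additive.ofMul s) =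
      if ∀ s ∈ S, χ (Additive.ofMul s) = 1 then (S.card : ℂ) else 0) :
    S.card * (Finset.univ.filter fun χ : AddChar (Additive G) ℂ => ∀ s ∈ S, χ (Additive.ofMul s) = 1).card =
      Fintype.card G := by
  have hA : ∑ χ : AddChar (Additive G) ℂ, ∑ s ∈ S, χ (Additive.ofMul s) = Fintype.card G := by
    rw [Finset.sum_comm, Finset.sum_congr rfl fun s _ => sum_char_apply_eq_ite_ib s, Finset.sum_ite_eq' S (1 : G),
      if_pos h1]
  have hB : ∑ χ : AddChar (Additive G) ℂ, ∑ s ∈ S, χ (Additive.ofMul s) =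
      (S.card : ℂ) * ((Finset.univ.filter fun χ : AddChar (Additive G) ℂ =>
        ∀ s ∈ S, χ (Additive.ofMul s) = 1).card : ℂ) := by
    rw [Finset.sum_congr rfl fun χ _ => hsum χ, ← Finset.sum_filter, Finset.sum_const, nsmul_eq_mul, mul_comm]
  have := hA.symm.trans hB
  exact_mod_cast this.symm

/-- `Σ_{χ|_S = 1} χ(ρ) = 0` when no `s ∈ S` has `sρ = 1` (`|S|·Σ_{χ|_S=1} χ(ρ) = Σ_{s∈S} Σ_χ χ(sρ) = 0`). [folklore] -/
private theorem sum_filter_apply_eq_zero_ib {S : Finset G} (hS : S.card ≠ 0)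
    (hsum : ∀ χ : AddChar (Additive G) ℂ, ∑ s ∈ S, χ (Additive.ofMul s) =
      if ∀ s ∈ S, χ (Additive.ofMul s) = 1 then (S.card : ℂ) else 0)
    (hρ : ∀ s ∈ S, s * ρ ≠ 1) :
    ∑ χ ∈ Finset.univ.filter (fun χ : AddChar (Additive G) ℂ => ∀ s ∈ S, χ (Additive.ofMul s) = 1),
      χ (Additive.ofMul ρ) = 0 := by
  have hS0 : (S.card : ℂ) ≠ 0 := by exact_mod_cast hS
  have hkey : ∑ χ : AddChar (Additive G) ℂ, (∑ s ∈ S, χ (Additive.ofMul s)) * χ (Additive.ofMul ρ) =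
      (S.card : ℂ) * ∑ χ ∈ Finset.univ.filter (fun χ : AddChar (Additive G) ℂ =>
        ∀ s ∈ S, χ (Additive.ofMul s) = 1), χ (Additive.ofMul ρ) := by
    rw [Finset.mul_sum, Finset.sum_filter]
    refine Finset.sum_congr rfl fun χ _ => ?_
    rw [hsum χ]
    split_ifs
    · rfl
    · rw [zero_mul]
  have hzero : ∑ χ : AddChar (Additive G) ℂ, (∑ s ∈ S, χ (Additive.ofMul s)) * χ (Additive.ofMul ρ) = 0 := by
    calc ∑ χ : AddChar (Additive G) ℂ, (∑ s ∈ S, χ (Additive.ofMul s)) * χ (Additive.ofMul ρ)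
        = ∑ χ : AddChar (Additive G) ℂ, ∑ s ∈ S, χ (Additive.ofMul (s * ρ)) := by
          refine Finset.sum_congr rfl fun χ _ => ?_
          rw [Finset.sum_mul]
          exact Finset.sum_congr rfl fun s _ => (char_mul_ib χ s ρ).symm
      _ = ∑ s ∈ S, ∑ χ : AddChar (Additive G) ℂ, χ (Additive.ofMul (s * ρ)) := Finset.sum_comm
      _ = ∑ s ∈ S, (0 : ℂ) := by
          refine Finset.sum_congr rfl fun s hs => ?_
          rw [sum_char_apply_eq_ite_ib, if_neg (hρ s hs)]
      _ = 0 := Finset.sum_const_zero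
  rw [hzero] at hkey
  rcases mul_eq_zero.1 hkey.symm with h0 | h0
  · exact absurd h0 hS0
  · exact h0

omit [Fintype G] [DecidableEq G] in
/-- If `Σ_{χ ∈ F} χ(ρ) = 0` and every `χ(ρ) = ±1` then half of `F` is odd. [folklore] -/
private theorem two_mul_card_filter_odd_eq_ib (h : IsCMTypeWith ρ (T : Set G)) {F : Finset (AddChar (Additive G) ℂ)}
    (h0 : ∑ χ ∈ F, χ (Additive.ofMul ρ) = 0) :
    2 * (F.filter fun χ => χ (Additive.ofMul ρ) = -1).card = F.card := by
  have hsum : ∑ χ ∈ F, (1 - χ (Additive.ofMul ρ)) = 2 * ((F.filter fun χ => χ (Additive.ofMul ρ) = -1).card : ℂ) := by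
    rw [Finset.sum_congr rfl (g := fun χ : AddChar (Additive G) ℂ => if χ (Additive.ofMul ρ) = -1 then (2 : ℂ) else 0)
      fun χ _ => ?_, ← Finset.sum_filter, Finset.sum_const, nsmul_eq_mul, mul_comm]
    rcases char_rho_ib h χ with e | e <;> rw [e] <;> norm_num
  rw [Finset.sum_sub_distrib, Finset.sum_const, nsmul_eq_mul, mul_one, h0, sub_zero] at hsum
  exact_mod_cast hsum.symm

/-- `k·|A| = n ⟺ B ⊆ A` when `A ⊆ B`, `k·|B| = n`, `k > 0`. [folklore] -/
private theorem mul_card_eq_iff_subset_ib {α : Type*} {A B : Finset α} {k n : ℕ} (hk : 0 < k) (hAB : A ⊆ B)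
    (hB : k * B.card = n) : k * A.card = n ↔ B ⊆ A := by
  constructor
  · intro hA
    have hc : A.card = B.card := Nat.eq_of_mul_eq_mul_left hk (hA.trans hB.symm)
    rw [Finset.eq_of_subset_of_card_le hAB hc.ge]
  · intro hBA
    rw [Finset.Subset.antisymm hAB hBA, hB]

end Helpers

/-! ## §1 The stabiliser `{g : Tg = T}` is a subgroup not containing `ρ` -/

section Subgroup

omit [Fintype G] [DecidableEq G] in
/-- `1` stabilises every `T`. [cite: Kubota1965, §2] -/
theorem forall_mul_one_mem_iff (T : Finset G) : ∀ t : G, t * 1 ∈ T ↔ t ∈ T := fun t => by rw [mul_one]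

omit [Fintype G] [DecidableEq G] in
/-- The stabiliser is closed under products. [cite: Kubota1965, §2] -/
theorem forall_mul_mul_mem_iff {x y : G} (hx : ∀ t : G, t * x ∈ T ↔ t ∈ T) (hy : ∀ t : G, t * y ∈ T ↔ t ∈ T) :
    ∀ t : G, t * (x * y) ∈ T ↔ t ∈ T := fun t => by
  rw [← mul_assoc, hy, hx]

omit [Fintype G] [DecidableEq G] in
/-- The stabiliser is closed under inverses. [cite: Kubota1965, §2] -/
theorem forall_mul_inv_mem_iff {x : G} (hx : ∀ t : G, t * x ∈ T ↔ t ∈ T) : ∀ t : G, t * x⁻¹ ∈ T ↔ t ∈ T :=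
  fun t => by rw [← hx (t * x⁻¹), inv_mul_cancel_right]

omit [Fintype G] [DecidableEq G] in
/-- **`ρ` never stabilises a CM type** (the tree's `not_forall_mul_rho_mem_iff`, the type being non-empty).
[cite: Kubota1965, §2] -/
theorem rho_not_forall_mul_mem_iff (h : IsCMTypeWith ρ (T : Set G)) : ¬ ∀ t : G, t * ρ ∈ T ↔ t ∈ T :=
  not_forall_mul_rho_mem_iff h (nonempty_ib h)

omit [Fintype G] [DecidableEq G] in
/-- No element `s` of the stabiliser has `sρ = 1` (else `ρ = s⁻¹` would stabilise). [cite: Kubota1965, §2] -/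
theorem mul_rho_ne_one_of_forall_mul_mem_iff (h : IsCMTypeWith ρ (T : Set G)) {s : G}
    (hs : ∀ t : G, t * s ∈ T ↔ t ∈ T) : s * ρ ≠ 1 := by
  intro hsρ
  apply rho_not_forall_mul_mem_iff h
  rw [eq_inv_of_mul_eq_one_right hsρ]
  exact forall_mul_inv_mem_iff hs

/-- A translate `Stab·s₀` of the stabiliser by one of its elements is the stabiliser. [cite: Kubota1965, §2] -/
theorem image_stabilizer_mul_eq {s₀ : G} (hs₀ : ∀ t : G, t * s₀ ∈ T ↔ t ∈ T) :
    (Finset.univ.filter fun g : G => ∀ t : G, t * g ∈ T ↔ t ∈ T).image (fun s => s * s₀) =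
      Finset.univ.filter fun g : G => ∀ t : G, t * g ∈ T ↔ t ∈ T := by
  apply Finset.eq_of_subset_of_card_le
  · intro x hx
    rw [Finset.mem_image] at hx
    obtain ⟨s, hs, rfl⟩ := hx
    simp only [Finset.mem_filter, Finset.mem_univ, true_and] at hs ⊢
    exact forall_mul_mul_mem_iff hs hs₀
  · rw [Finset.card_image_of_injective _ (mul_left_injective s₀)]

/-- The stabiliser contains `1`. [cite: Kubota1965, §2] -/
theorem one_mem_stabilizer (T : Finset G) :
    (1 : G) ∈ Finset.univ.filter fun g : G => ∀ t : G, t * g ∈ T ↔ t ∈ T := by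
  simp only [Finset.mem_filter, Finset.mem_univ, true_and]
  exact forall_mul_one_mem_iff T

/-- The stabiliser has positive cardinality. [cite: Kubota1965, §2] -/
theorem card_stabilizer_pos (T : Finset G) :
    0 < (Finset.univ.filter fun g : G => ∀ t : G, t * g ∈ T ↔ t ∈ T).card :=
  Finset.card_pos.2 ⟨1, one_mem_stabilizer T⟩

end Subgroup

/-! ## §2 Characters trivial on the stabiliser: `|S|·#{χ : χ|_S = 1} = |G|`, and half of them are odd -/

section Characters

/-- **`Σ_{s ∈ Stab} χ(s) = |Stab|` if `χ` is trivial on the stabiliser, `= 0` otherwise** (a value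
`χ(s₀) ≠ 1`, `s₀ ∈ Stab`, gives `Σ = χ(s₀)Σ` since `Stab·s₀ = Stab`, tree `sum_char_image_mul_eq`).
[cite: Kubota1965, §4 Lemma 2 (proof)] -/
theorem sum_char_stabilizer_eq (T : Finset G) (χ : AddChar (Additive G) ℂ) :
    ∑ s ∈ Finset.univ.filter (fun g : G => ∀ t : G, t * g ∈ T ↔ t ∈ T), χ (Additive.ofMul s) =
      if ∀ s ∈ Finset.univ.filter (fun g : G => ∀ t : G, t * g ∈ T ↔ t ∈ T), χ (Additive.ofMul s) = 1 then
        ((Finset.univ.filter fun g : G => ∀ t : G, t * g ∈ T ↔ t ∈ T).card : ℂ) else 0 := by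
  split_ifs with htriv
  · rw [Finset.sum_congr rfl fun s hs => htriv s hs, Finset.sum_const, nsmul_eq_mul, mul_one]
  · push Not at htriv
    obtain ⟨s₀, hs₀, hne⟩ := htriv
    have hs₀' : ∀ t : G, t * s₀ ∈ T ↔ t ∈ T := by
      simp only [Finset.mem_filter, Finset.mem_univ, true_and] at hs₀
      exact hs₀
    have h1 := sum_char_image_mul_eq χ (Finset.univ.filter fun g : G => ∀ t : G, t * g ∈ T ↔ t ∈ T) s₀
    rw [image_stabilizer_mul_eq hs₀'] at h1
    have h2 : (χ (Additive.ofMul s₀) - 1) *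
        ∑ s ∈ Finset.univ.filter (fun g : G => ∀ t : G, t * g ∈ T ↔ t ∈ T), χ (Additive.ofMul s) = 0 := by
      rw [sub_mul, one_mul, ← h1, sub_self]
    rcases mul_eq_zero.1 h2 with h3 | h3
    · exact absurd (sub_eq_zero.1 h3) hne
    · exact h3

/-- **`|Stab(T)|·#{χ : χ trivial on Stab(T)} = |G|`** — the characters trivial on the stabiliser are the
`[G : Stab(T)]` characters of `G/Stab(T)`; on the field side `[K* : ℚ] = [G : Gal(K/K*)]`.
[cite: Kubota1965, §4 Lemma 2 (proof)] [cite: Shimura1998, §8.4 Example (1)] -/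
theorem card_stabilizer_mul_card_filter_eq (T : Finset G) :
    (Finset.univ.filter fun g : G => ∀ t : G, t * g ∈ T ↔ t ∈ T).card *
      (Finset.univ.filter fun χ : AddChar (Additive G) ℂ =>
        ∀ s ∈ Finset.univ.filter (fun g : G => ∀ t : G, t * g ∈ T ↔ t ∈ T), χ (Additive.ofMul s) = 1).card =
      Fintype.card G :=
  card_mul_card_filter_eq_ib (one_mem_stabilizer T) (sum_char_stabilizer_eq T)

/-- **`|Stab(T)|` divides `|G|`.** [cite: Kubota1965, §2] -/
theorem card_stabilizer_dvd (T : Finset G) :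
    (Finset.univ.filter fun g : G => ∀ t : G, t * g ∈ T ↔ t ∈ T).card ∣ Fintype.card G :=
  Dvd.intro _ (card_stabilizer_mul_card_filter_eq T)

/-- **`Σ_{χ trivial on Stab(T)} χ(ρ) = 0`** for a CM type `T` (`|Stab|·Σ_{χ|_S=1} χ(ρ) = Σ_{s∈S} Σ_χ χ(sρ) = 0`, no
`s ∈ Stab(T)` having `sρ = 1`). [cite: Kubota1965, §4 Lemma 2 (proof)] -/
theorem sum_filter_apply_rho_eq_zero (h : IsCMTypeWith ρ (T : Set G)) :
    ∑ χ ∈ Finset.univ.filter (fun χ : AddChar (Additive G) ℂ =>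
      ∀ s ∈ Finset.univ.filter (fun g : G => ∀ t : G, t * g ∈ T ↔ t ∈ T), χ (Additive.ofMul s) = 1),
      χ (Additive.ofMul ρ) = 0 :=
  sum_filter_apply_eq_zero_ib (card_stabilizer_pos T).ne' (sum_char_stabilizer_eq T) fun s hs =>
    mul_rho_ne_one_of_forall_mul_mem_iff h (by simpa only [Finset.mem_filter, Finset.mem_univ, true_and] using hs)

/-- **Half of the characters trivial on `Stab(T)` are odd**: `2·#{χ : χ|_Stab = 1, χ(ρ) = −1} = #{χ : χ|_Stab = 1}`
(`χ(ρ) = ±1` and `Σ_{χ|_S=1} χ(ρ) = 0`). [cite: Kubota1965, §4 Lemma 2 (proof)] -/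
theorem two_mul_card_filter_odd_eq (h : IsCMTypeWith ρ (T : Set G)) :
    2 * ((Finset.univ.filter fun χ : AddChar (Additive G) ℂ =>
      ∀ s ∈ Finset.univ.filter (fun g : G => ∀ t : G, t * g ∈ T ↔ t ∈ T), χ (Additive.ofMul s) = 1).filter
        fun χ => χ (Additive.ofMul ρ) = -1).card =
      (Finset.univ.filter fun χ : AddChar (Additive G) ℂ =>
        ∀ s ∈ Finset.univ.filter (fun g : G => ∀ t : G, t * g ∈ T ↔ t ∈ T), χ (Additive.ofMul s) = 1).card :=
  two_mul_card_filter_odd_eq_ib h (sum_filter_apply_rho_eq_zero h)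

/-- **`2·|Stab(T)|·#{χ odd, χ trivial on Stab(T)} = |G|`.** [cite: Kubota1965, §4 Lemma 2 (proof)]
[cite: Shimura1998, §8.4 Example (1)] -/
theorem two_mul_card_stabilizer_mul_card_filter_odd_eq (h : IsCMTypeWith ρ (T : Set G)) :
    2 * (Finset.univ.filter fun g : G => ∀ t : G, t * g ∈ T ↔ t ∈ T).card *
      ((Finset.univ.filter fun χ : AddChar (Additive G) ℂ =>
        ∀ s ∈ Finset.univ.filter (fun g : G => ∀ t : G, t * g ∈ T ↔ t ∈ T), χ (Additive.ofMul s) = 1).filter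
        fun χ => χ (Additive.ofMul ρ) = -1).card = Fintype.card G := by
  rw [← card_stabilizer_mul_card_filter_eq T, ← two_mul_card_filter_odd_eq h]
  ring

end Characters

/-! ## §3 The bound `2·|Stab(T)|·(rank(T) − 1) ≤ |G|` and its equality case -/

section Bound

/-- The survivors are odd characters trivial on the stabiliser (tree `survivor_apply_eq_one_of_forall_mul_mem_iff`).
[cite: Kubota1965, §4 Lemma 2] -/
theorem survivors_subset_filter (T : Finset G) (ρ : G) :
    ((Finset.univ.filter fun χ : AddChar (Additive G) ℂ => χ (Additive.ofMul ρ) = -1).filter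
      fun χ => ∑ s ∈ T, χ (Additive.ofMul s) ≠ 0) ⊆
      (Finset.univ.filter fun χ : AddChar (Additive G) ℂ =>
        ∀ s ∈ Finset.univ.filter (fun g : G => ∀ t : G, t * g ∈ T ↔ t ∈ T), χ (Additive.ofMul s) = 1).filter
        fun χ => χ (Additive.ofMul ρ) = -1 := by
  intro χ hχ
  simp only [Finset.mem_filter, Finset.mem_univ, true_and] at hχ ⊢
  exact ⟨fun s hs => survivor_apply_eq_one_of_forall_mul_mem_iff hs hχ.1 hχ.2, hχ.1⟩

/-- **`2·|Stab(T)|·#survivors ≤ |G|`.** [cite: Kubota1965, §4 Lemma 2] [cite: Shimura1998, §32.10] -/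
theorem two_mul_card_stabilizer_mul_card_survivors_le (h : IsCMTypeWith ρ (T : Set G)) :
    2 * (Finset.univ.filter fun g : G => ∀ t : G, t * g ∈ T ↔ t ∈ T).card *
      ((Finset.univ.filter fun χ : AddChar (Additive G) ℂ => χ (Additive.ofMul ρ) = -1).filter
        fun χ => ∑ s ∈ T, χ (Additive.ofMul s) ≠ 0).card ≤ Fintype.card G := by
  rw [← two_mul_card_stabilizer_mul_card_filter_odd_eq h]
  exact Nat.mul_le_mul_left _ (Finset.card_le_card (survivors_subset_filter T ρ))

/-- **THE STABILISER BOUNDS THE RANK: `2·|Stab(T)|·(rank(T) − 1) ≤ |G|`** for every CM type `T` on a finite commutative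
group — `rank(T) ≤ [G : Stab(T)]/2 + 1`; on the field side (`K` abelian CM, `Stab(T) = Gal(K/K*)`):
`rank(K, Φ) ≤ [K* : ℚ]/2 + 1`, Shimura's reflex bound (tree `IsCMTypeWith.typeRank_le_card_orbit` in `G`-set form).
[cite: Shimura1998, §32.10] [cite: Kubota1965, §4 Lemma 2] -/
theorem two_mul_card_stabilizer_mul_typeRank_sub_one_le (h : IsCMTypeWith ρ (T : Set G)) :
    2 * (Finset.univ.filter fun g : G => ∀ t : G, t * g ∈ T ↔ t ∈ T).card * (typeRank G (T : Set G) - 1) ≤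
      Fintype.card G := by
  rw [typeRank_eq_one_add_card_ib h, Nat.add_sub_cancel_left]
  exact two_mul_card_stabilizer_mul_card_survivors_le h

/-- **`rank(T) ≤ |G|/(2|Stab(T)|) + 1 = [G : Stab(T)]/2 + 1`.** [cite: Shimura1998, §32.10] [cite: Kubota1965, §4 Lemma 2] -/
theorem typeRank_le_card_div_add_one (h : IsCMTypeWith ρ (T : Set G)) :
    typeRank G (T : Set G) ≤
      Fintype.card G / (2 * (Finset.univ.filter fun g : G => ∀ t : G, t * g ∈ T ↔ t ∈ T).card) + 1 := by
  have h1 := two_mul_card_stabilizer_mul_typeRank_sub_one_le h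
  have hpos : 0 < 2 * (Finset.univ.filter fun g : G => ∀ t : G, t * g ∈ T ↔ t ∈ T).card := by
    have := card_stabilizer_pos T
    omega
  have h2 : typeRank G (T : Set G) - 1 ≤
      Fintype.card G / (2 * (Finset.univ.filter fun g : G => ∀ t : G, t * g ∈ T ↔ t ∈ T).card) :=
    (Nat.le_div_iff_mul_le hpos).2 (by rwa [mul_comm] at h1)
  omega

/-- **A type stabilised by some `g ≠ 1` has `rank(T) ≤ |G|/4 + 1`** — on EVERY finite commutative group (the tree's
`ExponentTwo.typeRank_le_of_forall_mul_mem_iff` is the exponent-`2` case): `|Stab(T)| ≥ 2`. [cite: Shimura1998, §32.10]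
[cite: Kubota1965, §4 Lemma 2] -/
theorem typeRank_le_card_div_four_of_forall_mul_mem_iff (h : IsCMTypeWith ρ (T : Set G)) {g : G} (hg1 : g ≠ 1)
    (hg : ∀ t : G, t * g ∈ T ↔ t ∈ T) : typeRank G (T : Set G) ≤ Fintype.card G / 4 + 1 := by
  have h2S : 2 ≤ (Finset.univ.filter fun g : G => ∀ t : G, t * g ∈ T ↔ t ∈ T).card := by
    rw [← Finset.card_pair hg1]
    refine Finset.card_le_card fun x hx => ?_
    simp only [Finset.mem_insert, Finset.mem_singleton] at hx
    simp only [Finset.mem_filter, Finset.mem_univ, true_and]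
    rcases hx with rfl | rfl
    · exact hg
    · exact forall_mul_one_mem_iff T
  have h1 := two_mul_card_stabilizer_mul_typeRank_sub_one_le h
  have h4 : 4 * (typeRank G (T : Set G) - 1) ≤ Fintype.card G :=
    le_trans (Nat.mul_le_mul_right _ (by omega)) h1
  have h5 : typeRank G (T : Set G) - 1 ≤ Fintype.card G / 4 :=
    (Nat.le_div_iff_mul_le (by norm_num)).2 (by rwa [mul_comm] at h4)
  omega

/-- **THE EQUALITY CASE: `2·|Stab(T)|·(rank(T) − 1) = |G|` iff every odd character trivial on `Stab(T)` survives**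
(`Ŝ(χ) ≠ 0`) — i.e. iff `T`, induced from `G/Stab(T)`, is induced from a NONDEGENERATE type there (the odd characters
of `G/Stab(T)` being the odd characters of `G` trivial on `Stab(T)`).  Instances: nondegenerate types (`Stab = 1`),
kernel types (rank `2`), the majority types of an elementary abelian `2`-group (rank `5`, `|Stab| = |G|/8`).
[cite: Kubota1965, §2] [cite: Kubota1965, §4 Lemma 2] [cite: Shimura1998, §32.10] -/
theorem two_mul_card_stabilizer_mul_eq_iff (h : IsCMTypeWith ρ (T : Set G)) :
    2 * (Finset.univ.filter fun g : G => ∀ t : G, t * g ∈ T ↔ t ∈ T).card * (typeRank G (T : Set G) - 1) =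
      Fintype.card G ↔
      ∀ χ : AddChar (Additive G) ℂ, χ (Additive.ofMul ρ) = -1 →
        (∀ s : G, (∀ t : G, t * s ∈ T ↔ t ∈ T) → χ (Additive.ofMul s) = 1) → ∑ s ∈ T, χ (Additive.ofMul s) ≠ 0 := by
  have hpos : 0 < 2 * (Finset.univ.filter fun g : G => ∀ t : G, t * g ∈ T ↔ t ∈ T).card := by
    have := card_stabilizer_pos T
    omega
  rw [typeRank_eq_one_add_card_ib h, Nat.add_sub_cancel_left,
    mul_card_eq_iff_subset_ib hpos (survivors_subset_filter T ρ) (two_mul_card_stabilizer_mul_card_filter_odd_eq h),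
    Finset.subset_iff]
  simp only [Finset.mem_filter, Finset.mem_univ, true_and]
  exact ⟨fun H χ hχ htriv => (H ⟨htriv, hχ⟩).2, fun H χ hh => ⟨hh.2, H χ hh.2 hh.1⟩⟩

end Bound

end AbelianStabilizer

end CyclicCMType

end Literature.NumberTheory.ComplexMultiplication
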